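import Mathlib
import Summits.Ventures.PercRepro2.MixChordClasses
import Summits.Ventures.PercRepro2.ExistsChordRootEdge

/-!
# (MIX-CHORD) along the root edges at `a₃`, and the crux modulo the remaining root edges
(blind cell PercRepro2, night-1 g19; proofs/NIGHT1-G19.md §2)

* **`mixChord_root_edge`** / **`mixChord_root2_edge`**: along `f = {a₃, a₁}` (resp. `{a₃, a₂}`) the
  open end has `Gc = 0` (`D¹ = 0`), and the closed end is the cell's chord of `Gloc`, the root-edge
  chord theorem of g18 (`RootEdge.gloc_chord_root_edge`) multiplied by `D · Z`;
* **`ClosedClass`**: the root edges closed so far — internal (both ends in one weight-`1` root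
  cluster), bridge (one end in each), `{a₃, a₁}`, `{a₃, a₂}`;
* **`mixChord_of_remaining`** / **`HCov_all_of_mixChordRemaining_all`**: the row `Mix.MixChord`,
  hence the crux `CovForm.HCov_all`, from the mixed chord along the root edges of NO closed class
  (the far end outside the root clusters, not `a₃`: `o`, `b`, an unmarked vertex, or a vertex whose
  weight-`1` cluster carries such marks).

Own code; standard axioms.
-/

namespace Summit.Ventures.PercRepro2

open UnionCluster CovForm

namespace Mix

open scoped Classical

/-! ## The root edges at `a₃`: (MIX-CHORD) from the root-edge chord theorem of g18 -/

section RootA3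

variable {V : Type*} {E : Type*} [Fintype E] [DecidableEq E] [Fintype V] [DecidableEq V]
  {R : Type*} [Field R] [LinearOrder R] [IsStrictOrderedRing R]

variable (p : E → R) (ends : E → Sym2 V) (o : V) {a₁ a₂ a₃ : V} (b : V) {f : E}

/-- **(MIX-CHORD) along `f = {a₃, a₁}`**: the sure end has `Gc = 0` (`D¹ = 0`), and the closed end
is the cell's chord of `Gloc` (`RootEdge.gloc_chord_root_edge`, the root-edge chord theorem). -/
theorem mixChord_root_edge (hp : IsProbVec p) (hf : ends f = s(a₃, a₁)) :
    p f * Gc (Function.update p f 1) ends o a₁ a₂ a₃ b +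
      (1 - p f) * (shrink p ends a₁ a₂ a₃ f * Gc (Function.update p f 0) ends o a₁ a₂ a₃ b) ≤
        Gc p ends o a₁ a₂ a₃ b := by
  have hp0 : IsProbVec (Function.update p f 0) := hp.update f le_rfl zero_le_one
  have hp1 : IsProbVec (Function.update p f 1) := hp.update f zero_le_one le_rfl
  have hD1 : prob (Function.update p f 1) (PDEvent ends a₁ a₂ a₃) = 0 := by
    simpa using RootEdge.prob_PD_update_one p ends hf Set.univ
  have hG1 : Gc (Function.update p f 1) ends o a₁ a₂ a₃ b = 0 :=
    Chord.Gc_eq_zero_of_degenerate hp1 ends o a₁ a₂ a₃ b (by rw [hD1, zero_mul])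
  rw [hG1, mul_zero, zero_add]
  have hchord := RootEdge.gloc_chord_root_edge p ends o (a₂ := a₂) b hp hf
  unfold Chord.Gloc at hchord
  unfold shrink
  have hZ0 : 0 ≤ prob (Function.update p f 0) (avoidAll ends a₂ {a₁}) := prob_nonneg hp0 _
  have hD0 : 0 ≤ prob (Function.update p f 0) (PDEvent ends a₁ a₂ a₃) := prob_nonneg hp0 _
  have hZ : 0 ≤ prob p (avoidAll ends a₂ {a₁}) := prob_nonneg hp _
  have hD : 0 ≤ prob p (PDEvent ends a₁ a₂ a₃) := prob_nonneg hp _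
  have hq1 := hp.le_one f
  -- `D = (1 − q) D⁰` along a root edge
  have hDeq : prob p (PDEvent ends a₁ a₂ a₃) =
      (1 - p f) * prob (Function.update p f 0) (PDEvent ends a₁ a₂ a₃) :=
    RootEdge.prob_eq_of_update_one_eq_zero p _ (by simpa using RootEdge.prob_PD_update_one p ends hf Set.univ)
  by_cases hden : prob p (PDEvent ends a₁ a₂ a₃) * prob p (avoidAll ends a₂ {a₁}) = 0
  · -- `Gc p = 0` and the left side vanishes
    rw [Chord.Gc_eq_zero_of_degenerate hp ends o a₁ a₂ a₃ b hden, hden, zero_div, zero_mul,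
      mul_zero]
  · have hpos : 0 < prob p (PDEvent ends a₁ a₂ a₃) * prob p (avoidAll ends a₂ {a₁}) :=
      lt_of_le_of_ne (mul_nonneg hD hZ) (Ne.symm hden)
    by_cases hden0 : prob (Function.update p f 0) (PDEvent ends a₁ a₂ a₃) *
        prob (Function.update p f 0) (avoidAll ends a₂ {a₁}) = 0
    · -- impossible: `D⁰ = 0` forces `D = 0`, `Z⁰ = 0` forces `Z = 0`
      exfalso
      rcases mul_eq_zero.1 hden0 with h | h
      · apply hden
        rw [hDeq, h]
        ring
      · have hZmono : prob p (avoidAll ends a₂ {a₁}) ≤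
            prob (Function.update p f 0) (avoidAll ends a₂ {a₁}) :=
          EdmRow.prob_le_prob_update_zero_of_isLowerSet hp (EdmRow.isLowerSet_avoidAll ends a₁ a₂) f
        apply hden
        rw [le_antisymm (h ▸ hZmono) hZ]
        ring
    · have hpos0 : 0 < prob (Function.update p f 0) (PDEvent ends a₁ a₂ a₃) *
          prob (Function.update p f 0) (avoidAll ends a₂ {a₁}) :=
        lt_of_le_of_ne (mul_nonneg hD0 hZ0) (Ne.symm hden0)
      -- multiply the `Gloc` chord by `D · Z > 0`
      rw [mul_div_assoc', div_le_div_iff₀ hpos0 hpos] at hchord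
      have hre : (1 - p f) * (prob p (PDEvent ends a₁ a₂ a₃) * prob p (avoidAll ends a₂ {a₁}) /
          (prob (Function.update p f 0) (PDEvent ends a₁ a₂ a₃) *
            prob (Function.update p f 0) (avoidAll ends a₂ {a₁})) *
          Gc (Function.update p f 0) ends o a₁ a₂ a₃ b) =
          (1 - p f) * Gc (Function.update p f 0) ends o a₁ a₂ a₃ b *
            (prob p (PDEvent ends a₁ a₂ a₃) * prob p (avoidAll ends a₂ {a₁})) /
          (prob (Function.update p f 0) (PDEvent ends a₁ a₂ a₃) *
            prob (Function.update p f 0) (avoidAll ends a₂ {a₁})) := by ring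
      rw [hre, div_le_iff₀ hpos0]
      exact hchord

omit [Fintype V] [DecidableEq V] [LinearOrder R] [IsStrictOrderedRing R] in
/-- `shrink` is symmetric in the roots. -/
lemma shrink_root_swap (a₃ : V) (e : E) :
    shrink p ends a₂ a₁ a₃ e = shrink p ends a₁ a₂ a₃ e := by
  unfold shrink
  rw [PDEvent_root_swap, avoidAll_root_swap]

/-- **(MIX-CHORD) along `f = {a₃, a₂}`** (the root symmetry). -/
theorem mixChord_root2_edge (hp : IsProbVec p) (hf : ends f = s(a₃, a₂)) :
    p f * Gc (Function.update p f 1) ends o a₁ a₂ a₃ b +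
      (1 - p f) * (shrink p ends a₁ a₂ a₃ f * Gc (Function.update p f 0) ends o a₁ a₂ a₃ b) ≤
        Gc p ends o a₁ a₂ a₃ b := by
  have h := mixChord_root_edge p ends o (a₁ := a₂) (a₂ := a₁) b hp hf
  rw [shrink_root_swap, CovForm.Gc_swap p, CovForm.Gc_swap (Function.update p f 1),
    CovForm.Gc_swap (Function.update p f 0)] at h
  exact h

end RootA3

/-! ## The remaining root edges -/

section Remaining

variable {V : Type*} {E : Type*} [Fintype E] [DecidableEq E] [Fintype V] [DecidableEq V]
  {R : Type*} [Field R] [LinearOrder R] [IsStrictOrderedRing R]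

variable (p : E → R) (ends : E → Sym2 V) (a₁ a₂ a₃ : V) (e : E)

/-- A root edge of one of the closed classes: internal (both ends in one weight-`1` root
cluster), bridge (one end in each), or an edge `{a₃, a₁}` / `{a₃, a₂}`. -/
def ClosedClass : Prop :=
  (∃ x y, ends e = s(x, y) ∧ ((x ∈ cluster ends (Chord.oneConfig p) a₁ ∧
      y ∈ cluster ends (Chord.oneConfig p) a₁) ∨
    (x ∈ cluster ends (Chord.oneConfig p) a₂ ∧ y ∈ cluster ends (Chord.oneConfig p) a₂) ∨
    (x ∈ cluster ends (Chord.oneConfig p) a₁ ∧ y ∈ cluster ends (Chord.oneConfig p) a₂))) ∨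
  ends e = s(a₃, a₁) ∨ ends e = s(a₃, a₂)

/-- **(MIX-CHORD) modulo the remaining root edges**: the row at `p` follows from the mixed chord
along the root edges of no closed class. -/
theorem mixChord_of_remaining {p : E → R} {ends : E → Sym2 V} {o a₁ a₂ a₃ b : V}
    (hp : IsProbVec p)
    (h : ∀ e ∈ Chord.rootEdges p ends a₁ a₂, ¬ ClosedClass p ends a₁ a₂ a₃ e →
      p e * Gc (Function.update p e 1) ends o a₁ a₂ a₃ b +
        (1 - p e) * (shrink p ends a₁ a₂ a₃ e * Gc (Function.update p e 0) ends o a₁ a₂ a₃ b) ≤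
          Gc p ends o a₁ a₂ a₃ b) :
    MixChord p ends o a₁ a₂ a₃ b := by
  intro e he
  by_cases hc : ClosedClass p ends a₁ a₂ a₃ e
  · rcases hc with ⟨x, y, hxy, ⟨hx, hy⟩ | ⟨hx, hy⟩ | ⟨hx, hy⟩⟩ | hf | hf
    · exact mixChord_internal p hp (Chord.frac_of_mem_rootEdges he) hx hy hxy o a₁ a₂ a₃ b
    · exact mixChord_internal p hp (Chord.frac_of_mem_rootEdges he) hx hy hxy o a₁ a₂ a₃ b
    · exact mixChord_bridge p ends hp hx hy hxy o a₃ b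
    · exact mixChord_root_edge p ends o b hp hf
    · exact mixChord_root2_edge p ends o b hp hf
  · exact h e he hc

end Remaining

section RemainingAll

variable (R : Type*) [Field R] [LinearOrder R] [IsStrictOrderedRing R]

/-- Row (MIX-CHORD) assumed only along the root edges of no closed class. -/
def MixChordRemaining_all : Prop :=
  ∀ (V E : Type) [Fintype V] [DecidableEq V] [Fintype E] [DecidableEq E]
    (ends : E → Sym2 V) (p : E → R), IsProbVec p →
    ∀ o a₁ a₂ a₃ b : V, a₁ ≠ a₂ → a₁ ≠ a₃ → a₂ ≠ a₃ → o ≠ a₁ → o ≠ a₂ → o ≠ a₃ → o ≠ b →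
      b ≠ a₁ → b ≠ a₂ → b ≠ a₃ →
      ∀ e ∈ Chord.rootEdges p ends a₁ a₂, ¬ ClosedClass p ends a₁ a₂ a₃ e →
        p e * Gc (Function.update p e 1) ends o a₁ a₂ a₃ b +
          (1 - p e) * (shrink p ends a₁ a₂ a₃ e * Gc (Function.update p e 0) ends o a₁ a₂ a₃ b) ≤
            Gc p ends o a₁ a₂ a₃ b

/-- **The crux from (MIX-CHORD) along the remaining root edges alone.** -/
theorem HCov_all_of_mixChordRemaining_all (h : MixChordRemaining_all R) : HCov_all R :=
  HCov_all_of_mixChord_all R fun V E _ _ _ _ ends p hp o a₁ a₂ a₃ b h12 h13 h23 ho1 ho2 ho3 hob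
    hb1 hb2 hb3 =>
      mixChord_of_remaining hp
        (h V E ends p hp o a₁ a₂ a₃ b h12 h13 h23 ho1 ho2 ho3 hob hb1 hb2 hb3)

end RemainingAll

end Mix

end Summit.Ventures.PercRepro2
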